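import Summits.QuantumFields.BalabanUV.Beta.GAN24.ConvCKOfShapes

/-!
# `BalabanUV.Beta.GAN24.StripRegularPackaging` — binder row G-an2-4 / (CONV-C), road P1-fibre, typer row **P1-Y10r** (node N15r; the bookkeeping END of
# p1's leaf L10 `FibreStrip`): `StripRegular` WITH GIVEN `(κ, M)` — for inverse matrix multipliers, for `fibInv`, and for the offset-dressed step kernel `kFibΔ`

NOT IN PRINT; OUR PROOF ATTEMPT.  HONEST FRAMING (cell contract, verbatim): «discharging `BetaPertH` makes Bałaban's UV stability UNCONDITIONAL — a real
constructive-QFT result; it is NOT the continuum limit and NOT the Clay problem.»  HONEST DEPENDENCY (verbatim): «continuum YM on T⁴ ⇐ BetaPertH ∧ nine spine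
estimates (0/9 proved); BetaPertH ⇐ (D1) ∧ (D4) ∧ CAP+tail; G-an2-4 gates asym, D1 and NE2/3/4.»  [folklore] bookkeeping (no estimate: the `j`-UNIFORM numbers
`κ`, `Cst` are HYPOTHESES here — they are the analytic content (U1)/(U2) of p1's L10, NOT this row; no cited fact, no wall binder, no `def … : Prop`).  NOT summit
progress; nothing of (CONV-C)'s K-slot is discharged here.

## What is proved (generic `d`; `Strip (d+1) κ` of `B4Strip`, `StripRegular` of `B4ContourShift`, `StripHolo` of `FibreInverseDecay`)
* §1 GIVEN-CONSTANTS REGULARITY: `stripRegular_of_stripHolo` (StripHolo + a sup bound on the strip ⇒ StripRegular with THAT bound); for a matrix family `A` with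
  entrywise `StripHolo` entries, `(hκ : 0 ≤ κ) (hdet : ∀ p ∈ Strip (d+1) κ, (A p).det ≠ 0)` ⇒ every inverse entry `p ↦ (A p)⁻¹ i j` is `StripHolo` on the SAME strip
  (`stripHolo_inv_apply`: `inv_apply_eq` + `stripHolo_det`/`StripHolo.inv`/`stripHolo_adjugate` BY NAME — only `det ≠ 0` ON THE STRIP is needed), and with a bound
  `(hM : ∀ p ∈ Strip, ‖(A p)⁻¹ i j‖ ≤ M)` it is `StripRegular … κ M` (`stripRegular_inv_apply`); the `trigPolySymbol S L` instance (`stripHolo_trigPolySymbol_inv`,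
  `stripRegular_trigPolySymbol_inv`).  CONTRAST: `FibreInverseDecay.exists_stripRegular_inv` gives `∃ κ M` PER FAMILY by compactness (from `det ≠ 0` on the REAL zone) —
  useless for (I3′), whose `κ`, `Cst` must be `j`-UNIFORM; this file is the given-constants variant that the uniform estimates of L10 plug into.
* §2 the inverse-fibre entries `CombesThomasFibre.fibInv N i j` (`stripHolo_fibInv`, `stripRegular_fibInv`; `hdet` also in `fibreMatrix (blochChar p)` currency,
  `stripHolo_fibInv'`), and the finite leg sums `kFibW`, `kFib`, `kFibΔ` of `CombesThomasFibreStep` are `StripHolo` as soon as the fibre determinant has no zero on the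
  strip (`stripHolo_kFibW`, `stripHolo_kFib`, `stripHolo_kFibΔ` — `StripHolo.finset_sum/.mul`, `stripHolo_cphase`, `stripHolo_const`).
* §3 **THE PACKAGING**: `stripRegular_kFibΔ` — `StripRegular (kFibΔ Lc sf sm j a x′ b y′) κ Cst` from `hdet` on the strip at block side `Lc^(j+1)` AND a DIRECT sup bound
  `(hC : ∀ p ∈ Strip (d+1) κ, ‖kFibΔ … p‖ ≤ Cst)` — the factors are NEVER bounded separately (`kFibΔ = cphase (quo Lc y′ − quo Lc x′) · kFib` carries an offset phase of
  strip growth `e^{κ‖quo y′ − quo x′‖₁}` that only the product controls: p1's centring `unitK_KInvStep_eq_offset`); the family forms `stripRegularK_of_det_bound`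
  (`ConvCKOfShapes.StripRegularK`), **`unitDecayK_of_det_bound`** (feeds `CombesThomasFibreStep.unitDecayK_of_stripRegular` VERBATIM: `UnitDecayK d Lc sf sm (Cst·e^{2κ})
  (κ/((d+1)Lc))`) and **`convCK_of_det_bound_rate`** (feeds `ConvCKOfShapes.convCK_of_strip_rate`): so L10's deliverable is EXACTLY two `j`-uniform facts on `Strip (d+1) κ`,
  (U1) `det (fibre matrix at N = Lc^(j+1)) ≠ 0` and (U2) `‖kFibΔ_j‖ ≤ Cst`, for ONE `κ > 0`.
Unit `b2b-balaban-gan24-formalise-leaf-06` (G-an2-4 formalisation swarm), 2026-08-20.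
-/

noncomputable section

open Complex
open scoped BigOperators
open Literature.MathematicalPhysics.QuantumFieldTheory
open Literature.MathematicalPhysics.QuantumFieldTheory.Balaban1983to89
open Literature.MathematicalPhysics.QuantumFieldTheory.Balaban1983to89.Beta
open B4Strip (ofRealVec Strip)
open B4ContourShift (BZ StripRegular)
open FibreInverseDecay (StripHolo trigPolySymbol cphase stripHolo_det stripHolo_adjugate stripHolo_cphase stripHolo_const stripHolo_trigPolySymbol
  inv_apply_eq)
open BlochFibreMatrix (Idx stencil pieceMatrix fibreMatrix blochChar fibreMatrix_blochChar_eq_trigPolySymbol)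
open OneStepResolventKernel (Fib)
open Summit.QuantumFields.BalabanUV.Beta.GAN24.CombesThomas (ConvCK UnitDecayK sfStep smStep)
open Summit.QuantumFields.BalabanUV.Beta.GAN24.CombesThomasFibre (fibInv)
open Summit.QuantumFields.BalabanUV.Beta.GAN24.CombesThomasFibreStep (kFibW kFib kFibΔ unitDecayK_of_stripRegular)
open Summit.QuantumFields.BalabanUV.Beta.GAN24.ConvCKOfShapes (StripRegularK RealRateK convCK_of_strip_rate)

namespace Summit.QuantumFields.BalabanUV.Beta.GAN24.StripRegularPackaging

variable {d : ℕ}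

/-! ## §1 Strip regularity with GIVEN constants -/

/-- [folklore] `StripHolo` + a sup bound on the strip = `StripRegular` with that bound. -/
theorem stripRegular_of_stripHolo {G : (Fin (d + 1) → ℂ) → ℂ} {κ M : ℝ} (h : StripHolo G κ) (hM : ∀ p ∈ Strip (d + 1) κ, ‖G p‖ ≤ M) :
    StripRegular G κ M :=
  ⟨h.cont, h.diff, h.sides, hM⟩

section MatrixFamily

variable {n : Type*} [Fintype n] [DecidableEq n]

/-- [folklore] **INVERSE ENTRIES ARE STRIP HOLOMORPHIC WHERE THE DETERMINANT HAS NO ZERO ON THE STRIP**: `(A p)⁻¹ i j = det⁻¹ · adjugate i j`. -/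
theorem stripHolo_inv_apply {A : (Fin (d + 1) → ℂ) → Matrix n n ℂ} {κ : ℝ} (hκ : 0 ≤ κ) (hA : ∀ i j, StripHolo (fun p => A p i j) κ)
    (hdet : ∀ p ∈ Strip (d + 1) κ, (A p).det ≠ 0) (i j : n) : StripHolo (fun p => (A p)⁻¹ i j) κ := by
  have h := ((stripHolo_det hA).inv hκ hdet).mul (stripHolo_adjugate hA i j)
  have hfun : (fun p => (A p)⁻¹ i j) = fun p => ((A p).det)⁻¹ * (A p).adjugate i j := funext fun p => inv_apply_eq (A p) i j
  rw [hfun]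
  exact h

/-- [folklore] **GIVEN-CONSTANTS INVERSE REGULARITY**: with a sup bound `M` for the inverse entry on the strip, `StripRegular (p ↦ (A p)⁻¹ i j) κ M`.
(Contrast: `FibreInverseDecay.exists_stripRegular_inv` produces SOME `κ, M` per family; here both are the caller's.) -/
theorem stripRegular_inv_apply {A : (Fin (d + 1) → ℂ) → Matrix n n ℂ} {κ M : ℝ} (hκ : 0 ≤ κ) (hA : ∀ i j, StripHolo (fun p => A p i j) κ)
    (hdet : ∀ p ∈ Strip (d + 1) κ, (A p).det ≠ 0) (i j : n) (hM : ∀ p ∈ Strip (d + 1) κ, ‖(A p)⁻¹ i j‖ ≤ M) :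
    StripRegular (fun p => (A p)⁻¹ i j) κ M :=
  stripRegular_of_stripHolo (stripHolo_inv_apply hκ hA hdet i j) hM

/-- [folklore] The trigonometric-polynomial instance: inverse entries of `trigPolySymbol S L` are strip holomorphic off the zeros of `det` on the strip. -/
theorem stripHolo_trigPolySymbol_inv (S : Finset (Fin (d + 1) → ℤ)) (L : (Fin (d + 1) → ℤ) → Matrix n n ℂ) {κ : ℝ} (hκ : 0 ≤ κ)
    (hdet : ∀ p ∈ Strip (d + 1) κ, (trigPolySymbol S L p).det ≠ 0) (i j : n) :
    StripHolo (fun p => (trigPolySymbol S L p)⁻¹ i j) κ :=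
  stripHolo_inv_apply hκ (fun i' j' => stripHolo_trigPolySymbol S L κ i' j') hdet i j

/-- [folklore] … and `StripRegular` with any given sup bound. -/
theorem stripRegular_trigPolySymbol_inv (S : Finset (Fin (d + 1) → ℤ)) (L : (Fin (d + 1) → ℤ) → Matrix n n ℂ) {κ M : ℝ} (hκ : 0 ≤ κ)
    (hdet : ∀ p ∈ Strip (d + 1) κ, (trigPolySymbol S L p).det ≠ 0) (i j : n) (hM : ∀ p ∈ Strip (d + 1) κ, ‖(trigPolySymbol S L p)⁻¹ i j‖ ≤ M) :
    StripRegular (fun p => (trigPolySymbol S L p)⁻¹ i j) κ M :=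
  stripRegular_of_stripHolo (stripHolo_trigPolySymbol_inv S L hκ hdet i j) hM

end MatrixFamily

/-! ## §2 The inverse-fibre entries and the leg sums on a strip -/

section Fibre

variable {N : ℕ} [NeZero N]

/-- [folklore] `fibInv N i j` is strip holomorphic on every strip free of zeros of the fibre determinant. -/
theorem stripHolo_fibInv {κ : ℝ} (hκ : 0 ≤ κ)
    (hdet : ∀ p ∈ Strip (d + 1) κ, (trigPolySymbol (stencil (d + 1)) (pieceMatrix (N := N)) p).det ≠ 0) (i j : Idx (d + 1) N) :
    StripHolo (fibInv N i j) κ :=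
  stripHolo_trigPolySymbol_inv _ _ hκ hdet i j

/-- [folklore] The same with the determinant hypothesis in `fibreMatrix (blochChar p)` currency (an2's `fibreMatrix_blochChar_eq_trigPolySymbol`). -/
theorem stripHolo_fibInv' {κ : ℝ} (hκ : 0 ≤ κ)
    (hdet : ∀ p ∈ Strip (d + 1) κ, (fibreMatrix (N := N) (⇑(blochChar p))).det ≠ 0) (i j : Idx (d + 1) N) :
    StripHolo (fibInv N i j) κ :=
  stripHolo_fibInv hκ (fun p hp => by rw [← fibreMatrix_blochChar_eq_trigPolySymbol]; exact hdet p hp) i j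

/-- [folklore] `StripRegular (fibInv N i j) κ M` from `det ≠ 0` on the strip and a given sup bound. -/
theorem stripRegular_fibInv {κ M : ℝ} (hκ : 0 ≤ κ)
    (hdet : ∀ p ∈ Strip (d + 1) κ, (trigPolySymbol (stencil (d + 1)) (pieceMatrix (N := N)) p).det ≠ 0) (i j : Idx (d + 1) N)
    (hM : ∀ p ∈ Strip (d + 1) κ, ‖fibInv N i j p‖ ≤ M) : StripRegular (fibInv N i j) κ M :=
  stripRegular_of_stripHolo (stripHolo_fibInv hκ hdet i j) hM

/-- [folklore] The phase-dressed leg sum `kFibW` is strip holomorphic (finite sum of constant · `cphase` · `fibInv`). -/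
theorem stripHolo_kFibW {κ : ℝ} (hκ : 0 ≤ κ)
    (hdet : ∀ p ∈ Strip (d + 1) κ, (trigPolySymbol (stencil (d + 1)) (pieceMatrix (N := N)) p).det ≠ 0)
    (M : ℕ) (sf sm : ℝ) (a : Fib d) (x' : Fin (d + 1) → ℤ) (b : Fib d) (y' : Fin (d + 1) → ℤ) :
    StripHolo (kFibW N M sf sm a x' b y') κ := by
  unfold kFibW
  refine StripHolo.finset_sum _ fun ii _ => ?_
  exact (stripHolo_const _ κ).mul ((stripHolo_cphase _ κ).mul (stripHolo_fibInv hκ hdet _ _))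

end Fibre

section Step

variable {Lc : ℕ} [NeZero Lc]

/-- [folklore] `kFib Lc sf sm j …` is strip holomorphic off the zeros of the step-`j` fibre determinant (block side `Lc^(j+1)`). -/
theorem stripHolo_kFib {κ : ℝ} (hκ : 0 ≤ κ) (sf sm : ℕ → ℝ) (j : ℕ)
    (hdet : ∀ p ∈ Strip (d + 1) κ, (trigPolySymbol (stencil (d + 1)) (pieceMatrix (N := Lc ^ (j + 1))) p).det ≠ 0)
    (a : Fib d) (x' : Fin (d + 1) → ℤ) (b : Fib d) (y' : Fin (d + 1) → ℤ) :
    StripHolo (kFib Lc sf sm j a x' b y') κ :=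
  stripHolo_kFibW hκ hdet _ _ _ a x' b y'

/-- [folklore] `kFibΔ = cphase (quo Lc y′ − quo Lc x′) · kFib` is strip holomorphic (same hypothesis). -/
theorem stripHolo_kFibΔ {κ : ℝ} (hκ : 0 ≤ κ) (sf sm : ℕ → ℝ) (j : ℕ)
    (hdet : ∀ p ∈ Strip (d + 1) κ, (trigPolySymbol (stencil (d + 1)) (pieceMatrix (N := Lc ^ (j + 1))) p).det ≠ 0)
    (a : Fib d) (x' : Fin (d + 1) → ℤ) (b : Fib d) (y' : Fin (d + 1) → ℤ) :
    StripHolo (kFibΔ Lc sf sm j a x' b y') κ := by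
  unfold kFibΔ
  exact (stripHolo_cphase _ κ).mul (stripHolo_kFib hκ sf sm j hdet a x' b y')

/-! ## §3 The packaging: `StripRegular (kFibΔ …) κ Cst` and the hand-off to (I3′) / `ConvCK` -/

/-- [folklore] **`StripRegular (kFibΔ Lc sf sm j a x′ b y′) κ Cst`** from (U1) no zero of the step-`j` fibre determinant on `Strip (d+1) κ` and (U2) a DIRECT sup bound
`Cst` of `kFibΔ` on that strip (never factorwise: the offset phase is unbounded on the strip and is only controlled inside the product). -/
theorem stripRegular_kFibΔ {κ Cst : ℝ} (hκ : 0 ≤ κ) (sf sm : ℕ → ℝ) (j : ℕ)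
    (hdet : ∀ p ∈ Strip (d + 1) κ, (trigPolySymbol (stencil (d + 1)) (pieceMatrix (N := Lc ^ (j + 1))) p).det ≠ 0)
    (a : Fib d) (x' : Fin (d + 1) → ℤ) (b : Fib d) (y' : Fin (d + 1) → ℤ)
    (hC : ∀ p ∈ Strip (d + 1) κ, ‖kFibΔ Lc sf sm j a x' b y' p‖ ≤ Cst) :
    StripRegular (kFibΔ Lc sf sm j a x' b y') κ Cst :=
  stripRegular_of_stripHolo (stripHolo_kFibΔ hκ sf sm j hdet a x' b y') hC

/-- [folklore] The family form in the literal units: (U1) ∀ j, no zero of the step-`j` determinant on the strip; (U2) ∀ j x′ y′ a b, the sup bound `Cst`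
⇒ `ConvCKOfShapes.StripRegularK d Lc κ Cst` (shape A of the K-slot). -/
theorem stripRegularK_of_det_bound {κ Cst : ℝ} (hκ : 0 ≤ κ)
    (hdet : ∀ j, ∀ p ∈ Strip (d + 1) κ, (trigPolySymbol (stencil (d + 1)) (pieceMatrix (N := Lc ^ (j + 1))) p).det ≠ 0)
    (hC : ∀ (j : ℕ) (x' y' : Fin (d + 1) → ℤ) (a b : Fib d), ∀ p ∈ Strip (d + 1) κ,
      ‖kFibΔ Lc (sfStep Lc) (smStep d Lc) j a x' b y' p‖ ≤ Cst) :
    StripRegularK d Lc κ Cst :=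
  fun j x' y' a b => stripRegular_kFibΔ hκ _ _ j (hdet j) a x' b y' (hC j x' y' a b)

/-- [folklore] **(I3′) FROM (U1)+(U2)**, general units: `UnitDecayK d Lc sf sm (Cst·e^{2κ}) (κ/((d+1)·Lc))` — `CombesThomasFibreStep.unitDecayK_of_stripRegular` fed verbatim. -/
theorem unitDecayK_of_det_bound (sf sm : ℕ → ℝ) {κ Cst : ℝ} (hκ : 0 ≤ κ)
    (hdet : ∀ j, ∀ p ∈ Strip (d + 1) κ, (trigPolySymbol (stencil (d + 1)) (pieceMatrix (N := Lc ^ (j + 1))) p).det ≠ 0)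
    (hC : ∀ (j : ℕ) (x' y' : Fin (d + 1) → ℤ) (a b : Fib d), ∀ p ∈ Strip (d + 1) κ, ‖kFibΔ Lc sf sm j a x' b y' p‖ ≤ Cst) :
    UnitDecayK d Lc sf sm (Cst * Real.exp (2 * κ)) (κ / ((d + 1) * Lc)) :=
  unitDecayK_of_stripRegular sf sm hκ fun j x' y' a b => stripRegular_kFibΔ hκ sf sm j (hdet j) a x' b y' (hC j x' y' a b)

/-- [folklore] **THE K-SLOT FROM (U1)+(U2)+(I2′)** in the literal units `(sfStep Lc, smStep d Lc)`: `ConvCK d Lc` — `ConvCKOfShapes.convCK_of_strip_rate` fed verbatim.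
What remains for road P1 after this file: the three `j`-UNIFORM analytic facts (U1), (U2) (p1's L10, one `κ > 0`, one `Cst`) and the real-zone rate (p1's L11). -/
theorem convCK_of_det_bound_rate {κ Cst c θ : ℝ} (hκ : 0 < κ) (hc : 0 ≤ c) (hθ0 : 0 ≤ θ) (hθ1 : θ < 1)
    (hdet : ∀ j, ∀ p ∈ Strip (d + 1) κ, (trigPolySymbol (stencil (d + 1)) (pieceMatrix (N := Lc ^ (j + 1))) p).det ≠ 0)
    (hC : ∀ (j : ℕ) (x' y' : Fin (d + 1) → ℤ) (a b : Fib d), ∀ p ∈ Strip (d + 1) κ,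
      ‖kFibΔ Lc (sfStep Lc) (smStep d Lc) j a x' b y' p‖ ≤ Cst)
    (hB : RealRateK d Lc c θ) : ConvCK d Lc :=
  convCK_of_strip_rate hκ hc hθ0 hθ1 (stripRegularK_of_det_bound hκ.le hdet hC) hB

end Step

end Summit.QuantumFields.BalabanUV.Beta.GAN24.StripRegularPackaging

end
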